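import Summits.AtomisticToContinuum.BoseEinsteinCondensation.Theorems.BECThomsonPrincipleGDTransferSeededIntegrableDefs
import Summits.AtomisticToContinuum.BoseEinsteinCondensation.Theorems.BECThomsonPrincipleGDTransferSeededPairPotentialBound
import HarnessLib

/-!
# Route `BECThomsonPrinciple`, crux `GDTransfer` (stmt-AtomisticToContinuum-9482), line `seeded-continuity`
# (skeleton v7): the stub `stub_pairPotentialBoundInt` — the pair-potential bound on kinetic-bounded states,
# `L^{3/2}` form

Registered stub `stub_pairPotentialBoundInt : Sig.stub_pairPotentialBoundInt` (`= PairPotentialBoundInt` of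
`…SeededIntegrableDefs.lean`, the analytic heart of the INTEGRABLE transport device of the line): at fixed particle
number `N = m + 1`, side `L > 0`, support radius `R`, kinetic budget `K < ∞` and `ε > 0` there is `η > 0` such that
every measurable radial profile `w` vanishing beyond `R` with `∫_{ℝ³} w(|x|)^{3/2} dx ≤ η` — no boundedness of `w` is
assumed, `w` may even take the value `∞` on a null set — has interaction energy
`∫_{cell^N} (Σ_{i<j} w^per(xᵢ − xⱼ)) |Φ|² ≤ ε` on every periodic trial state `Φ` with `∫_{cell^N} |∇Φ|² ≤ K`.

Proof.  The v6 device `PairBound.lintegral_interaction_le` (fibrewise Hölder `L^{3/2} · L³` in one particle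
coordinate at frozen others + the periodic Sobolev inequality `torusSobolev_weight_bound`, file
`…SeededPairPotentialBound.lean`) already bounds the interaction energy by `N · N · (Δ · C · (K + 1))` given
`(∫_cell w^per(· − y)^{3/2})^{2/3} ≤ Δ` for all `y`.  The only new input is this `L^{3/2}(cell)` bound for an
UNBOUNDED profile, which here comes from the `L^{3/2}(ℝ³)` mass of the lift instead of a sup bound:

* `PairBound.exists_images_finset` — uniformly in `z ∈ ℝ³`, the lattice points `n` with `‖z − Ln‖ ≤ R` lie in a box
  of at most `C_img(L, R) = (⌈2R/L⌉ + 1)³` points (the counting of `exists_bound_periodizedPotential`);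
* `PairBound.periodizedPotential_rpow_le` — hence only finitely many images contribute to `w^per(z)` and the finite
  power-mean inequality `(Σ_{n∈S} a_n)^p ≤ |S|^{p−1} Σ_{n∈S} a_n^p` (`ENNReal.rpow_sum_le_const_mul_sum_rpow`) gives
  `(w^per)^p ≤ C_img^{p−1} (w^p)^per` pointwise, `1 ≤ p`;
* `PairBound.lintegral_cell_rpow_le_images` — with `p = 3/2` and the tiling identity
  `∫_cell (w^{3/2})^per(x − y) dx = ∫_{ℝ³} w(|z|)^{3/2} dz` (`lintegral_cell_periodizedPotential_sub`):
  `∫_cell w^per(x − y)^{3/2} dx ≤ C_img^{1/2} ∫_{ℝ³} w(|z|)^{3/2} dz`;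
* `stub_pairPotentialBoundInt` — the choice of `η`: `Δ := ε/(Q+1)` with `Q = N² C (K+1)` and
  `η := Δ^{3/2}/(C_img^{1/2} + 1)` (the ENNReal bookkeeping of v6's `stub_pairPotentialBound`).

References: LiebLoss2001 Thm. 8.3 (Sobolev inequality); LSSY2005 §1.2 (1.16), Ch. 2 (2.1) (the energy form and
the admissible class); Fournais2020 (1.1) (the periodic problem).
-/

noncomputable section

open MeasureTheory Filter Set
open scoped ENNReal NNReal

namespace Summit.AtomisticToContinuum.BoseEinsteinCondensation.Cruxes.GDTransfer.Seeded

open Literature.MathematicalPhysics.QuantumManyBody.BoseGas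

namespace PairBound

variable {L : ℝ}

/-! ### Finitely many lattice images and the power-mean inequality -/

/-- **Finitely many lattice images, uniformly in the point.** For `L > 0` and a radius `R` there is `Cimg : ℕ`
such that for every `z ∈ ℝ³` the lattice points `n ∈ ℤ³` with `‖z − Ln‖ ≤ R` lie in a finite set of at most `Cimg`
elements (the box `∏ₖ [⌈(zₖ − R')/L⌉, ⌊(zₖ + R')/L⌋]`, `R' = max R 0`, of side `≤ ⌈2R'/L⌉ + 1`; the counting of
`exists_bound_periodizedPotential`). [folklore] -/
theorem exists_images_finset (hL : 0 < L) (R : ℝ) : ∃ Cimg : ℕ, ∀ z : Space,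
    ∃ S : Finset (Fin 3 → ℤ), S.card ≤ Cimg ∧ ∀ n ∉ S, R < ‖z - latticeVec L n‖ := by
  set R' : ℝ := max R 0 with hR'
  set K : ℕ := ⌈2 * R' / L⌉₊ + 1 with hK
  refine ⟨K ^ 3, fun z => ?_⟩
  set S : Finset (Fin 3 → ℤ) :=
    Fintype.piFinset fun k => Finset.Icc ⌈(z k - R') / L⌉ ⌊(z k + R') / L⌋ with hS
  refine ⟨S, ?_, fun n hn => ?_⟩
  · -- the box has at most `K³` points
    rw [hS, Fintype.card_piFinset, ← Fin.prod_const]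
    refine Finset.prod_le_prod' fun k _ => ?_
    rw [Int.card_Icc]
    refine (Int.toNat_le).2 ?_
    have h1 : ((⌊(z k + R') / L⌋ : ℤ) : ℝ) ≤ (z k + R') / L := Int.floor_le _
    have h2 : (z k - R') / L ≤ ((⌈(z k - R') / L⌉ : ℤ) : ℝ) := Int.le_ceil _
    have h3 : (2 * R' / L : ℝ) ≤ (⌈2 * R' / L⌉₊ : ℕ) := Nat.le_ceil _
    have h4 : ((⌊(z k + R') / L⌋ - ⌈(z k - R') / L⌉ : ℤ) : ℝ) ≤ ((⌈2 * R' / L⌉₊ : ℕ) : ℝ) := by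
      push_cast
      have : (z k + R') / L - (z k - R') / L = 2 * R' / L := by field_simp; ring
      linarith
    have h5 : (⌊(z k + R') / L⌋ - ⌈(z k - R') / L⌉ : ℤ) ≤ ((⌈2 * R' / L⌉₊ : ℕ) : ℤ) := by
      exact_mod_cast h4
    rw [hK]; push_cast; linarith
  · -- off the box the image is farther than `R' ≥ R`
    rw [hS, Fintype.mem_piFinset] at hn
    push Not at hn
    obtain ⟨k, hk⟩ := hn
    rw [Finset.mem_Icc, not_and_or, not_le, not_le] at hk
    have hcoord : |z k - L * n k| ≤ ‖z - latticeVec L n‖ := by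
      have := Summit.AtomisticToContinuum.BoseEinsteinCondensation.Theorems.abs_apply_le_norm_space
        (z - latticeVec L n) k
      simpa [latticeVec] using this
    refine lt_of_lt_of_le ?_ hcoord
    refine lt_of_le_of_lt (le_max_left R 0) ?_
    rcases hk with hk | hk
    · -- `n k < ⌈(z k - R')/L⌉`, i.e. `L n k < z k - R'`
      have h1 : ((n k : ℤ) : ℝ) < (z k - R') / L := Int.lt_ceil.1 hk
      rw [lt_div_iff₀ hL] at h1
      rw [lt_abs]; left; linarith
    · -- `⌊(z k + R')/L⌋ < n k`, i.e. `z k + R' < L n k`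
      have h1 : (z k + R') / L < ((n k : ℤ) : ℝ) := Int.floor_lt.1 hk
      rw [div_lt_iff₀ hL] at h1
      rw [lt_abs]; right; linarith

/-- **Power-mean bound for the periodisation of a finite-range profile.** If every point has at most `Cimg`
lattice images within distance `R` (`exists_images_finset`) and `w` vanishes beyond `R`, then for `1 ≤ p`
`(w^per z)^p ≤ Cimg^{p-1} · (w^p)^per z` (only finitely many images contribute, and
`(Σ_{n∈S} a_n)^p ≤ |S|^{p-1} Σ_{n∈S} a_n^p`, `ENNReal.rpow_sum_le_const_mul_sum_rpow`). [folklore] -/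
theorem periodizedPotential_rpow_le {R : ℝ} {Cimg : ℕ}
    (hS : ∀ z : Space, ∃ S : Finset (Fin 3 → ℤ), S.card ≤ Cimg ∧ ∀ n ∉ S, R < ‖z - latticeVec L n‖)
    {w : ℝ → ℝ≥0∞} (hwR : ∀ r, R < r → w r = 0) {p : ℝ} (hp : 1 ≤ p) (z : Space) :
    periodizedPotential w L z ^ p ≤
      (Cimg : ℝ≥0∞) ^ (p - 1) * periodizedPotential (fun r => w r ^ p) L z := by
  obtain ⟨S, hcard, hoff⟩ := hS z
  have hp0 : 0 < p := one_pos.trans_le hp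
  have h0 : ∀ n ∉ S, w ‖z - latticeVec L n‖ = 0 := fun n hn => hwR _ (hoff n hn)
  have h0p : ∀ n ∉ S, w ‖z - latticeVec L n‖ ^ p = 0 := fun n hn => by
    rw [h0 n hn, ENNReal.zero_rpow_of_pos hp0]
  simp only [periodizedPotential]
  rw [tsum_eq_sum (s := S) h0, tsum_eq_sum (s := S) h0p]
  calc (∑ n ∈ S, w ‖z - latticeVec L n‖) ^ p
      ≤ (S.card : ℝ≥0∞) ^ (p - 1) * ∑ n ∈ S, w ‖z - latticeVec L n‖ ^ p :=
        ENNReal.rpow_sum_le_const_mul_sum_rpow S _ hp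
    _ ≤ (Cimg : ℝ≥0∞) ^ (p - 1) * ∑ n ∈ S, w ‖z - latticeVec L n‖ ^ p := by
        gcongr ?_ * _
        exact ENNReal.rpow_le_rpow (by exact_mod_cast hcard) (by linarith)

/-- **The `L^{3/2}` mass of a shifted periodised finite-range profile on the cell**:
`∫_cell w^per(x − y)^{3/2} dx ≤ Cimg^{1/2} ∫_{ℝ³} w(|z|)^{3/2} dz` for a measurable profile `w` vanishing beyond `R`
(`periodizedPotential_rpow_le` with `p = 3/2` and the tiling identity `lintegral_cell_periodizedPotential_sub` for the
profile `w^{3/2}`). No boundedness of `w` is needed. [folklore] -/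
theorem lintegral_cell_rpow_le_images (hL : 0 < L) {R : ℝ} {Cimg : ℕ}
    (hS : ∀ z : Space, ∃ S : Finset (Fin 3 → ℤ), S.card ≤ Cimg ∧ ∀ n ∉ S, R < ‖z - latticeVec L n‖)
    {w : ℝ → ℝ≥0∞} (hw : Measurable w) (hwR : ∀ r, R < r → w r = 0) (y : Space) :
    ∫⁻ x in cell L, periodizedPotential w L (x - y) ^ ((3 : ℝ) / 2) ≤
      (Cimg : ℝ≥0∞) ^ ((1 : ℝ) / 2) * ∫⁻ z : Space, w ‖z‖ ^ ((3 : ℝ) / 2) := by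
  have hp : (1 : ℝ) ≤ 3 / 2 := by norm_num
  have hmeas : Measurable fun x : Space => periodizedPotential (fun r => w r ^ ((3 : ℝ) / 2)) L (x - y) :=
    (measurable_periodizedPotential (hw.pow_const _) L).comp (measurable_id.sub_const y)
  calc ∫⁻ x in cell L, periodizedPotential w L (x - y) ^ ((3 : ℝ) / 2)
      ≤ ∫⁻ x in cell L, (Cimg : ℝ≥0∞) ^ ((3 : ℝ) / 2 - 1) *
          periodizedPotential (fun r => w r ^ ((3 : ℝ) / 2)) L (x - y) :=
        lintegral_mono fun x => periodizedPotential_rpow_le hS hwR hp _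
    _ = (Cimg : ℝ≥0∞) ^ ((3 : ℝ) / 2 - 1) *
          ∫⁻ x in cell L, periodizedPotential (fun r => w r ^ ((3 : ℝ) / 2)) L (x - y) :=
        lintegral_const_mul _ hmeas
    _ = (Cimg : ℝ≥0∞) ^ ((1 : ℝ) / 2) * ∫⁻ z : Space, w ‖z‖ ^ ((3 : ℝ) / 2) := by
        rw [lintegral_cell_periodizedPotential_sub hL (hw.pow_const _) y,
          show ((3 : ℝ) / 2 - 1) = 1 / 2 by norm_num]

end PairBound

open PairBound

/-- **Stub (D') `stub_pairPotentialBoundInt`: the pair-potential bound on kinetic-bounded states, `L^{3/2}` form.**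
At fixed `N = m + 1`, `L > 0`, `R`, `K < ∞` and `ε > 0` there is `η > 0` such that every measurable radial profile `w`
vanishing beyond `R` with `∫_{ℝ³} w(|x|)^{3/2} dx ≤ η` has `∫_{cell^N} (Σ_{i<j} w^per(xᵢ − xⱼ)) |Φ|² ≤ ε` on every
periodic trial state `Φ` with `∫_{cell^N} |∇Φ|² ≤ K`.  Fibrewise Hölder `L^{3/2} · L³` in one particle coordinate at
frozen others and the periodic Sobolev inequality `H¹(cell) ⊂ L⁶(cell)` (`torusSobolev_weight_bound`,
`PairBound.lintegral_interaction_le`), finitely many lattice images and the power-mean inequality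
(`PairBound.exists_images_finset`, `PairBound.lintegral_cell_rpow_le_images`):
`‖w^per(· − y)‖_{L^{3/2}(cell)} ≤ C_img^{1/3} ‖w(|·|)‖_{L^{3/2}(ℝ³)}`. [cite: LiebLoss2001, Thm. 8.3] -/
theorem stub_pairPotentialBoundInt : Sig.stub_pairPotentialBoundInt := by
  intro m L hL R K hK ε hε
  obtain ⟨C, hC, hS⟩ := torusSobolev_weight_bound L hL
  obtain ⟨Cimg, hCimg⟩ := exists_images_finset hL R
  -- the constants
  set N : ℝ≥0∞ := ((m + 1 : ℕ) : ℝ≥0∞) with hN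
  set Q : ℝ≥0∞ := N * (N * (C * (K + 1))) with hQ
  have hNtop : N ≠ ⊤ := ENNReal.natCast_ne_top _
  have hQtop : Q ≠ ⊤ := ENNReal.mul_ne_top hNtop (ENNReal.mul_ne_top hNtop
    (ENNReal.mul_ne_top hC (ENNReal.add_ne_top.2 ⟨hK, ENNReal.one_ne_top⟩)))
  have hQ1 : Q + 1 ≠ 0 := by simp
  have hQ1' : Q + 1 ≠ ⊤ := ENNReal.add_ne_top.2 ⟨hQtop, ENNReal.one_ne_top⟩
  -- the target for `Δ`
  set δ₀ : ℝ≥0∞ := ENNReal.ofReal ε / (Q + 1) with hδ₀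
  have hδ₀pos : 0 < δ₀ := ENNReal.div_pos_iff.2 ⟨(ENNReal.ofReal_pos.2 hε).ne', hQ1'⟩
  have hδ₀top : δ₀ ≠ ⊤ := (ENNReal.div_lt_top ENNReal.ofReal_ne_top hQ1).ne
  have hQδ : Q * δ₀ ≤ ENNReal.ofReal ε := by
    calc Q * δ₀ ≤ (Q + 1) * δ₀ := by gcongr; exact le_self_add
      _ = ENNReal.ofReal ε := ENNReal.mul_div_cancel hQ1 hQ1'
  -- the image constant `D = C_img^{1/2}` and the target for `∫ w^{3/2}`
  set D : ℝ≥0∞ := (Cimg : ℝ≥0∞) ^ ((1 : ℝ) / 2) with hD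
  have hDtop : D ≠ ⊤ := ENNReal.rpow_ne_top_of_nonneg (by norm_num) (ENNReal.natCast_ne_top _)
  have hD1 : D + 1 ≠ 0 := by simp
  have hD1' : D + 1 ≠ ⊤ := ENNReal.add_ne_top.2 ⟨hDtop, ENNReal.one_ne_top⟩
  set η₀ : ℝ≥0∞ := δ₀ ^ ((3 : ℝ) / 2) / (D + 1) with hη₀
  have hη₀pos : 0 < η₀ := ENNReal.div_pos_iff.2 ⟨(ENNReal.rpow_pos hδ₀pos hδ₀top).ne', hD1'⟩
  have hη₀top : η₀ ≠ ⊤ :=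
    (ENNReal.div_lt_top (ENNReal.rpow_ne_top_of_nonneg (by norm_num) hδ₀top) hD1).ne
  have hDη : D * η₀ ≤ δ₀ ^ ((3 : ℝ) / 2) := by
    calc D * η₀ ≤ (D + 1) * η₀ := by gcongr; exact le_self_add
      _ = δ₀ ^ ((3 : ℝ) / 2) := ENNReal.mul_div_cancel hD1 hD1'
  refine ⟨η₀.toReal, ENNReal.toReal_pos hη₀pos.ne' hη₀top, fun w hw hwR hint Φ hkin => ?_⟩
  rw [ENNReal.ofReal_toReal hη₀top] at hint
  -- `Δ := δ₀` works
  have hA : ∀ y : Space,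
      (∫⁻ x in cell L, periodizedPotential w L (x - y) ^ ((3 : ℝ) / 2)) ^ ((2 : ℝ) / 3) ≤ δ₀ := by
    intro y
    have h1 : ∫⁻ x in cell L, periodizedPotential w L (x - y) ^ ((3 : ℝ) / 2) ≤ δ₀ ^ ((3 : ℝ) / 2) :=
      calc ∫⁻ x in cell L, periodizedPotential w L (x - y) ^ ((3 : ℝ) / 2)
          ≤ D * ∫⁻ z : Space, w ‖z‖ ^ ((3 : ℝ) / 2) := lintegral_cell_rpow_le_images hL hCimg hw hwR y
        _ ≤ D * η₀ := by gcongr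
        _ ≤ δ₀ ^ ((3 : ℝ) / 2) := hDη
    calc (∫⁻ x in cell L, periodizedPotential w L (x - y) ^ ((3 : ℝ) / 2)) ^ ((2 : ℝ) / 3)
        ≤ (δ₀ ^ ((3 : ℝ) / 2)) ^ ((2 : ℝ) / 3) := ENNReal.rpow_le_rpow h1 (by norm_num)
      _ = δ₀ := by
          rw [← ENNReal.rpow_mul, show ((3 : ℝ) / 2) * (2 / 3) = 1 by norm_num, ENNReal.rpow_one]
  calc ∫⁻ X in cellN (m + 1) L, periodicInteraction w L X * (‖Φ.ψ X‖₊ : ℝ≥0∞) ^ 2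
      ≤ N * (N * (δ₀ * C * ((∫⁻ X in cellN (m + 1) L, kineticDensity Φ.ψ X) + 1))) :=
        lintegral_interaction_le hL Φ hw hC hδ₀top hS hA
    _ ≤ N * (N * (δ₀ * C * (K + 1))) := by gcongr
    _ = Q * δ₀ := by rw [hQ]; ring
    _ ≤ ENNReal.ofReal ε := hQδ

end Summit.AtomisticToContinuum.BoseEinsteinCondensation.Cruxes.GDTransfer.Seeded

end
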